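import Summits.ABC.IUTFork.Charitable.Thm311D2IsoSeparationKit
import HarnessLib

/-!
# [IUTchIII] Cor. 3.12 — branch D, team D2: rung (v) — the ISO-RUNG does NOT give `S` (a separating instance)

Record file (D-0012; abc-iut cell, branch D, rung LADDER-ABC:A2.D; census row (R1b) of `HOME/plan/D2/CHARITY-D2.md` §10, item (v);
seat abc-iut-D2-prv gen 2 — CONTINGENCY build sanctioned by ANCHOR RULING #3 (abc-iut-D2-typ g5, STATUS 2026-08-26T10:28:06Z) after
abc-iut-D2-cx g3's claim of 09:18:39Z went silent; authorship priority stays with D2-cx for any bytes he files). TAKES NO SIDE on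
[IUTchIII] Cor. 3.12 or on any author. MODEL DATA (a packet automorphism, a q-datum, a Cor.-3.12 setting over abc-iut-w5-d230's SPLIT
model P♮₁ `Cor312PilotKummerSplit*`, p429981 ff.) + kernel facts about them; NO `Prop` fact.

THE QUESTION. Rows (i)–(iv) of (R1b) (p434633 / p435015 / p436181–p437277) leave open whether the ISO-RUNG — «in every packet the
q-pilot's region is the image of the Θ-region under SOME admissibility- and log-volume-preserving linear automorphism» — might after all
give `S := PilotKummerIndRelated` back (then it would be a datum-level S-rung like III-c-2). Over 1-dimensional packets with ball-valued
`ρ` no separation is possible (every isometry of a `p`-adic line fixes every ball). THIS FILE separates over P♮₁'s split packets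
`(ℚ²)^{⊗(j+1)}` (two valuations over one place; hull-sets the BOXES `box D`, log-volume `−1 − #deepSet`, everything admissible):
* (KIT `Charitable/Thm311D2IsoSeparationKit.lean`) §1 `flipLast` — the packet automorphism swapping the two SUMMANDS of the LAST tensor factor (coordinates `c ↦ flipIdx c`, the last bit
  negated): it carries `box D` onto `box (flipFin D)` (`image_box_flipLast`) and preserves the log-volume of EVERY region
  (`splitVol_image_flipLast`) — an ISOMETRY in the sense of (R1b) (`flipLast_isoAdmAt`); it is NOT a capsule permutation, hence outside
  `⟨(Ind1)∪(Ind2)⟩`'s action on regions (§4).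
* §2 the flipped Θ-point generates the box `box (DFlipped j)`, deep exactly on `{c | c(j) = true}` (`pointBox_flipLast_thetaPt`).
* §3 `flippedSetting` — P♮₁'s setting with the q-pilot glue reading the FLIPPED box (q-datum `qDatumFlipped := flipLast·{θ}`): the three
  pins, every bridge hypothesis, `|log(q)| > 0` and the typed Thm. 3.11 hold; the ISO-RUNG holds with `e := flipLast` in every packet
  (`flipped_isoRung`), and so does the NAMED rung `III_c_IsoTransportRegion` (`flipped_isoTransportRegion`); hence the typed Corollary
  holds — derived HERE by the volume route of p434633 (`flipped_statement`).
* §4 **`S` FAILS** (`flipped_not_pilotKummerIndRelated`): every `⟨(Ind1)∪(Ind2)⟩`-translate of the Θ-box is a box `box (permD σ (DTheta j))`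
  containing the all-`false` coordinate as a deep one, at which the flipped Θ-point has coordinate `2^j > 1`; and the official square
  III-c-2 fails (`flipped_not_square`). §5 packages the tuple (`isoRung_not_imp_S`).
So the iso-rung (and the named `III_c_IsoTransportRegion`) is STRICTLY WEAKER than the load-bearing clause and does NOT carry `S`: row
(R1b) is an inequality-only rung (class DIAGNOSTIC, anchor ruling #2), incomparable with the hull rung. HONEST SCOPE: interface-level toy
(l⋆ = 2, two valuations, toy volumes with Θ/q ratio 1 — as (iii) `isoRung_false_of_honest` forces for any instance of the rung).
Source of the nouns: S. Mochizuki, *Inter-universal Teichmüller theory III* (May 2020) = `paper:url-4b091feeb646`, Thm. 3.11 (i) (Ind1)/(Ind2)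
p. 154, (iii)(c) p. 158 l. 5–15. Typed ≠ proved; locates / conditionally verifies; no abc claim. [claim: Mochizuki2012, status: disputed]
-/

noncomputable section

open Set

namespace Summit.ABC.IUTFork.Charitable.D2

open Thm311 Cor312 Cor312Vol Cor312Vol.SplitWitness Literature.IUT.LogThetaLattice

/-! ## 3. The flipped setting: q-pilot glue reading the flipped box -/

/-- **The q-pilot's Kummer datum of the separating instance**: the `flipLast`-translate of the Θ-datum `{θ}`. [folklore] -/
def qDatumFlipped : ∀ v : splitIndex.V, v ∈ splitIndex.Vbad → Set (splitShells.StarPacket v) :=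
  fun v _ => splitShells.starAut flipLast v '' {thetaStar v}

/-- The box region of the flipped q-datum at a label of `𝔽_l^⋆` is the flipped box. [folklore] -/
theorem boxRegion_qDatumFlipped {j : splitIndex.Label} (hj : j ≠ 0) (vQ : splitIndex.VQ) :
    boxRegion qDatumFlipped j vQ = box (DFlipped j) := by
  unfold boxRegion qDatumFlipped
  rw [dif_neg hj]
  simp only [Set.image_singleton, Set.mem_singleton_iff, Set.iUnion_iUnion_eq_left]
  exact pointBox_flipLast_thetaPt hj vQ

/-- The q-glue reading the `△`-object of exponent `k` as the box deep to depth `2 − k` on the FLIPPED deep set; the shallow box at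
the zero label. [folklore] -/
def qRegionFlipped (k : ℤ) (j : splitIndex.Label) (vQ : splitIndex.VQ) : Set (splitShells.Packet j vQ) :=
  if j = 0 then box ∅ else boxLE (2 - (k : ℚ)) (DFlipped j)

/-- At exponent `1` the flipped q-glue is the hull-set `box (DFlipped j)` on `𝔽_l^⋆`. [folklore] -/
theorem qRegionFlipped_one_of_ne_zero {j : splitIndex.Label} (hj : j ≠ 0) (vQ : splitIndex.VQ) :
    qRegionFlipped 1 j vQ = box (DFlipped j) := by
  unfold qRegionFlipped; rw [if_neg hj]; norm_num; rfl

/-- At the zero label the flipped q-glue is the shallow box. [folklore] -/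
theorem qRegionFlipped_zero (k : ℤ) (vQ : splitIndex.VQ) : qRegionFlipped k 0 vQ = box ∅ := if_pos rfl

/-- `qRegionFlipped 1` is a hull-set at every label. [folklore] -/
theorem qRegionFlipped_one_mem (j : splitIndex.Label) (vQ : splitIndex.VQ) : qRegionFlipped 1 j vQ ∈ splitHul j vQ := by
  by_cases hj : j = 0
  · subst hj; rw [qRegionFlipped_zero]; exact ⟨∅, rfl⟩
  · rw [qRegionFlipped_one_of_ne_zero hj]; exact ⟨_, rfl⟩

/-- **The separating setting**: P♮₁'s `splitSetting` (abc-iut-w5-d230) with ONLY the q-pilot glue changed to read the flipped box.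
[folklore] -/
def flippedSetting : Setting splitSituation :=
  { splitSetting with
    qRegionOf := fun k j vQ => qRegionFlipped k j vQ
    qRegion_mem := fun j vQ => qRegionFlipped_one_mem j vQ
    qSupport_finite := fun _ => Set.toFinite _ }

/-- The pilots are unchanged (exponent `1`). [folklore] -/
theorem flippedSetting_pilots : flippedSetting.thetaPilot = (1 : ℤ) ∧ flippedSetting.qPilot = (1 : ℤ) := splitSetting_pilots

/-- The Θ-side of the flipped setting IS P♮₁'s (same fields). [folklore] -/
theorem flippedSetting_thetaRegion (m : ℤ) (j : splitIndex.Label) (vQ : splitIndex.VQ) :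
    flippedSetting.thetaRegion m j vQ = splitSetting.thetaRegion m j vQ := rfl

/-- … hence the same (Ind3)-enlarged regions … [folklore] -/
theorem flippedSetting_thetaRegion3 (j : splitIndex.Label) (vQ : splitIndex.VQ) :
    flippedSetting.thetaRegion3 j vQ = splitSetting.thetaRegion3 j vQ := rfl

/-- … the same local Θ-terms … [folklore] -/
theorem flippedSetting_thetaLocal (j : splitIndex.Label) (vQ : splitIndex.VQ) :
    flippedSetting.thetaLocal j vQ = splitSetting.thetaLocal j vQ := rfl

/-- … and the same finiteness of `−|log(Θ)|`. [folklore] -/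
theorem flippedSetting_thetaFinite : flippedSetting.ThetaFinite := splitSetting_thetaFinite

/-- The q-region on `𝔽_l^⋆` is the flipped box. [folklore] -/
theorem flippedSetting_qRegion_of_ne_zero {j : splitIndex.Label} (hj : j ≠ 0) (vQ : splitIndex.VQ) :
    flippedSetting.qRegion j vQ = box (DFlipped j) := by
  unfold Setting.qRegion; rw [flippedSetting_pilots.2]; exact qRegionFlipped_one_of_ne_zero hj vQ

/-- The q-region at the zero label is the shallow box. [folklore] -/
theorem flippedSetting_qRegion_zero (vQ : splitIndex.VQ) : flippedSetting.qRegion 0 vQ = box ∅ := by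
  unfold Setting.qRegion; rw [flippedSetting_pilots.2]; exact qRegionFlipped_zero 1 vQ

/-- **Every bridge hypothesis holds** at the flipped setting (Θ-side and frame as in P♮₁). [folklore] -/
theorem flippedSetting_bridgeHyps : BridgeHyps flippedSetting where
  mono := fun _ _ _ _ _ _ hAB => splitVol_mono hAB
  image_adm := fun _ _ _ _ => trivial
  image_fin := fun _ => Set.toFinite _
  hul_nonempty := fun _ _ _ hH => by obtain ⟨D, rfl⟩ := hH; exact ⟨0, zero_mem_boxLE zero_le_one D⟩
  theta_nonempty := fun i vQ => by
    rw [flippedSetting_thetaRegion3, (splitSetting_regions_of_ne_zero (Setting.labelSucc_ne_zero i) vQ).1]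
    exact ⟨0, zero_mem_boxLE zero_le_one _⟩
  finite := flippedSetting_thetaFinite

/-- The local q-volume at a label of `𝔽_l^⋆` equals P♮₁'s: the flipped box has as many deep coordinates as the Θ-box. [folklore] -/
theorem flippedSetting_qLocal (i : Fin splitIndex.lstar) (vQ : splitIndex.VQ) :
    flippedSetting.qLocal (Setting.labelSucc i) vQ = -1 - ((DTheta (Setting.labelSucc i)).card : ℝ) := by
  have hj := Setting.labelSucc_ne_zero i
  unfold Setting.qLocal
  rw [flippedSetting_qRegion_of_ne_zero hj, DFlipped_eq_flipFin, ← image_box_flipLast _ vQ (DTheta _)]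
  show splitVol _ vQ (flipLast _ vQ '' box (DTheta _)) = _
  rw [splitVol_image_flipLast, splitVol_box_DTheta hj]

/-- **`|log(q)| > 0`** at the flipped setting (`−|log(q)| = −4`, as in P♮₁). [folklore] -/
theorem flippedSetting_absLogQPos : flippedSetting.AbsLogQPos := by
  show flippedSetting.negLogQ < 0
  unfold Setting.negLogQ processionNormalized
  simp only [finsum_unique, flippedSetting_qLocal]
  have h : ∀ i : Fin splitIndex.lstar, (-1 - ((DTheta (Setting.labelSucc i)).card : ℝ)) ≤ -1 := fun i => by
    have : (0 : ℝ) ≤ (DTheta (Setting.labelSucc i)).card := Nat.cast_nonneg _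
    linarith
  have hs : ∑ i : Fin splitIndex.lstar, (-1 - ((DTheta (Setting.labelSucc i)).card : ℝ)) ≤ ∑ _i : Fin splitIndex.lstar, (-1 : ℝ) :=
    Finset.sum_le_sum fun i _ => h i
  have hl : (splitIndex.lstar : ℝ) = 2 := by norm_num [splitIndex]
  rw [hl]
  have : ∑ _i : Fin splitIndex.lstar, (-1 : ℝ) = -2 := by simp [splitIndex]
  linarith

/-- **(hρ) ∧ (pΘ) — the Θ-pilot pin HOLDS** (as in P♮₁: same operator, same Θ-side). [folklore] -/
theorem flippedSetting_thetaPinned : ThetaPinned splitFull.toLatticeSituation flippedSetting boxRegion := splitSetting_thetaPinned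

/-- **(pq′) — the q-pilot pin HOLDS** for the flipped datum. [folklore] -/
theorem flippedSetting_qPinned : QPinned splitFull.toLatticeSituation flippedSetting boxRegion qDatumFlipped := fun j vQ => by
  by_cases hj : j = 0
  · subst hj
    rw [boxRegion_zero]; exact flippedSetting_qRegion_zero vQ
  · rw [flippedSetting_qRegion_of_ne_zero hj, boxRegion_qDatumFlipped hj]

/-- **(pL) — the link pin HOLDS** (identity of exponents, as in P♮₁). [folklore] -/
theorem flippedSetting_pilotLink : Thm311ToCor312.PilotLink flippedSetting :=
  ⟨Equiv.refl ℤ, by rw [flippedSetting_pilots.1, flippedSetting_pilots.2]; rfl⟩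

/-- **`PinnedRegions3` HOLDS** at the separating instance. [folklore] -/
theorem flippedSetting_pinnedRegions3 : PinnedRegions3 splitFull.toLatticeSituation flippedSetting boxRegion qDatumFlipped :=
  ⟨⟨flippedSetting_thetaPinned, flippedSetting_qPinned⟩, flippedSetting_pilotLink⟩

/-- Thm. 3.11 (ii)(b) at the column of the setting (from the typed Thm. 3.11 of P♮₁). [folklore] -/
theorem flippedSetting_kummerB :
    (splitFull.toLatticeSituation.col flippedSetting.n).KummerB (splitFull.toLatticeSituation.D flippedSetting.n) :=
  GluedMonoids.kummerB_of_statement splitFull splitFull_statement _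

/-- **THE ISO-RUNG HOLDS** at the separating instance, at every label: in each packet the q-region is the image of the Θ-region under
the isometry `flipLast`. [folklore] -/
theorem flipped_isoRung (j : splitIndex.Label) (vQ : splitIndex.VQ) :
    ∃ e : splitShells.Packet j vQ ≃ₗ[ℚ] splitShells.Packet j vQ,
      (∀ A : Set (splitShells.Packet j vQ), (splitFull.toLatticeSituation.D flippedSetting.n).Adm j vQ A →
        (splitFull.toLatticeSituation.D flippedSetting.n).Adm j vQ (e '' A) ∧
          (splitFull.toLatticeSituation.D flippedSetting.n).logvol j vQ (e '' A) =
            (splitFull.toLatticeSituation.D flippedSetting.n).logvol j vQ A) ∧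
      ∃ m : ℤ, boxRegion qDatumFlipped j vQ =
        e '' boxRegion ((splitFull.toLatticeSituation.col flippedSetting.n).frobΨ m) j vQ := by
  refine ⟨flipLast j vQ, fun A _ => ⟨trivial, splitVol_image_flipLast j vQ A⟩, 0, ?_⟩
  show boxRegion qDatumFlipped j vQ = flipLast j vQ '' boxRegion (fun v _ => {thetaStar v}) j vQ
  by_cases hj : j = 0
  · subst hj
    rw [boxRegion_zero, boxRegion_zero, image_box_flipLast]
    unfold flipFin; rw [Finset.image_empty]
  · rw [boxRegion_qDatumFlipped hj, boxRegion_theta hj, image_box_flipLast, DFlipped_eq_flipFin]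

/-- **The NAMED rung `III_c_IsoTransportRegion` HOLDS** too (one family `flipLast`, Θ-datum at column `n−1`; abc-iut-D2-typ p435015).
[folklore] -/
theorem flipped_isoTransportRegion :
    III_c_IsoTransportRegion splitFull.toLatticeSituation flippedSetting.n boxRegion qDatumFlipped := by
  refine ⟨flipLast, flipLast_isoAdmAt _, 0, fun j vQ => ?_⟩
  show boxRegion qDatumFlipped j vQ = flipLast j vQ '' boxRegion (fun v _ => {thetaStar v}) j vQ
  by_cases hj : j = 0
  · subst hj
    rw [boxRegion_zero, boxRegion_zero, image_box_flipLast]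
    unfold flipFin; rw [Finset.image_empty]
  · rw [boxRegion_qDatumFlipped hj, boxRegion_theta hj, image_box_flipLast, DFlipped_eq_flipFin]

/-- **The typed Corollary 3.12 HOLDS** at the separating instance — derived by the VOLUME ROUTE of the group ladder
(`statement_of_isoRung'`, p434633), exercising row (ii) non-vacuously. [folklore] -/
theorem flipped_statement : flippedSetting.Statement :=
  statement_of_isoRung' splitFull.toLatticeSituation flippedSetting boxRegion qDatumFlipped flippedSetting_bridgeHyps
    flippedSetting_kummerB flippedSetting_pinnedRegions3.1 flipped_isoRung

/-! ## 4. `S` FAILS at the separating instance -/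

/-- The flipped Θ-point is NOT deep at the all-`false` coordinate (its coordinate there is `2^j > 1` for `j ≥ 1`). [folklore] -/
theorem not_abs_coord_constFalse_flipLast_thetaPt_le_one {j : splitIndex.Label} (hj : j ≠ 0) (vQ : splitIndex.VQ) :
    ¬ |coord j vQ (fun _ => false) (flipLast j vQ (thetaPt j vQ))| ≤ 1 := by
  rw [coord_flipLast, abs_coord_thetaPt_le_one_iff hj, flipIdx_last]
  simp

/-- The flipped Θ-point lies in the flipped box. [folklore] -/
theorem flipLast_thetaPt_mem_box (j : splitIndex.Label) (vQ : splitIndex.VQ) :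
    flipLast j vQ (thetaPt j vQ) ∈ (box (DFlipped j) : Set (splitShells.Packet j vQ)) := by
  refine ⟨fun c => ?_, fun c hc => ?_⟩
  · rw [coord_flipLast]; exact abs_coord_thetaPt_le vQ (j := j) _
  · rw [coord_flipLast_thetaPt]
    unfold DFlipped at hc
    rw [Finset.mem_filter] at hc
    rw [hc.2]; simp

/-- **`S := PilotKummerIndRelated` FAILS** at the separating instance: at the label `1 ∈ 𝔽_l^⋆` every possible Θ-datum
`D′ ∈ ^{n,∘}𝔯^{LGP}` has splitting-monoid region `box (permD σ (DTheta 1))` for the capsule permutation `σ` through which its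
transporting element of `⟨(Ind1)∪(Ind2)⟩` acts — a box deep at the all-`false` coordinate —, while the q-region `box (DFlipped 1)` contains
the flipped Θ-point, which is not deep there. [folklore] -/
theorem flipped_not_pilotKummerIndRelated :
    ¬ PilotKummerIndRelated splitFull.toLatticeSituation flippedSetting boxRegion qDatumFlipped := by
  intro hS
  have hj : (Setting.labelSucc (0 : Fin splitIndex.lstar) : splitIndex.Label) ≠ 0 := Setting.labelSucc_ne_zero _
  obtain ⟨D', hD', hq⟩ := hS (Setting.labelSucc (0 : Fin splitIndex.lstar)) ()
  obtain ⟨Φ, hΦ, hΨ⟩ := GluedMonoids.exists_closure_psi_eq_of_mem_RLGP (L := splitShells) hD'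
  have hΨ' : D'.Ψ = fun v hv => splitShells.starAut Φ v '' {thetaStar v} := funext fun v => funext fun hv => hΨ v hv
  obtain ⟨σ, hσ⟩ := actsByPerm_of_mem_closure hΦ (Setting.labelSucc (0 : Fin splitIndex.lstar)) ()
  rw [boxRegion_qDatumFlipped hj, hΨ', boxRegion_equivariant (actsByPerm_of_mem_closure hΦ), boxRegion_theta hj,
    image_box_of_perm hσ] at hq
  have hmem := flipLast_thetaPt_mem_box (Setting.labelSucc (0 : Fin splitIndex.lstar)) ()
  rw [hq] at hmem
  -- the all-`false` coordinate is deep for every capsule-permutation translate of the Θ-box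
  -- (cf. abc-iut Repair lane's `CandMochizuki32Split.const_false_mem_permD`, same one-liner; not re-declared here)
  have hc0 : (fun _ => false) ∈ permD σ (DTheta (Setting.labelSucc (0 : Fin splitIndex.lstar))) := by
    rw [mem_permD_iff]; unfold DTheta; rw [Finset.mem_filter]; exact ⟨Finset.mem_univ _, rfl⟩
  exact not_abs_coord_constFalse_flipLast_thetaPt_le_one hj () (hmem.2 _ hc0)

/-- **The official load-bearing square III-c-2 FAILS** at the separating instance (it would give `S`, p428699, since I-perm and II-b
hold for P♮₁'s typed Thm. 3.11) — so here the iso-rung is STRICTLY weaker than the square. [folklore] -/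
theorem flipped_not_square : ¬ III_c_KummerLinkSquare splitFull.toLatticeSituation flippedSetting.n qDatumFlipped := fun hsq =>
  have hpI := perm_and_IIb_of_fullStatement splitFull splitFull_statement
  flipped_not_pilotKummerIndRelated
    (pilotKummerIndRelated_of_square splitFull.toLatticeSituation flippedSetting boxRegion qDatumFlipped hpI.1 hpI.2 hsq)

/-! ## 5. Rung (v), packaged -/

/-- **RUNG (v) OF ROW (R1b): THE ISO-RUNG DOES NOT IMPLY `S`.** There is a three-pinned setting with the typed Thm. 3.11, every bridge
hypothesis and `|log(q)| > 0` at which the ISO-RUNG holds in every packet (and the named `III_c_IsoTransportRegion` holds), the typed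
Corollary holds (volume route), while `S := PilotKummerIndRelated` FAILS and the official square III-c-2 FAILS. So the `¬∀`-schema
«iso-rung ∧ pins ∧ bridge hypotheses ⟹ S» is refuted, and (R1b) is an inequality-only rung. Interface-level toy (two valuations over one
place, box volumes, Θ/q volume ratio `1`); no side taken. [folklore] -/
theorem isoRung_not_imp_S :
    ∃ (T : ThetaIndex) (F : FullSituation T) (P : Setting F.toLatticeSituation.toSituation)
      (ρ : (∀ v : T.V, v ∈ T.Vbad → Set (F.L.StarPacket v)) → ∀ (j : T.Label) (vQ : T.VQ), Set (F.L.Packet j vQ))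
      (qK : ∀ v : T.V, v ∈ T.Vbad → Set (F.L.StarPacket v)),
      F.Statement ∧ BridgeHyps P ∧ P.AbsLogQPos ∧ PinnedRegions3 F.toLatticeSituation P ρ qK ∧
      (∀ (j : T.Label) (vQ : T.VQ), ∃ e : F.L.Packet j vQ ≃ₗ[ℚ] F.L.Packet j vQ,
        (∀ A : Set (F.L.Packet j vQ), (F.toLatticeSituation.D P.n).Adm j vQ A →
          (F.toLatticeSituation.D P.n).Adm j vQ (e '' A) ∧
            (F.toLatticeSituation.D P.n).logvol j vQ (e '' A) = (F.toLatticeSituation.D P.n).logvol j vQ A) ∧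
        ∃ m : ℤ, ρ qK j vQ = e '' ρ ((F.toLatticeSituation.col P.n).frobΨ m) j vQ) ∧
      III_c_IsoTransportRegion F.toLatticeSituation P.n ρ qK ∧ P.Statement ∧
      ¬ PilotKummerIndRelated F.toLatticeSituation P ρ qK ∧ ¬ III_c_KummerLinkSquare F.toLatticeSituation P.n qK :=
  ⟨splitIndex, splitFull, flippedSetting, boxRegion, qDatumFlipped, splitFull_statement, flippedSetting_bridgeHyps,
    flippedSetting_absLogQPos, flippedSetting_pinnedRegions3, flipped_isoRung, flipped_isoTransportRegion, flipped_statement,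
    flipped_not_pilotKummerIndRelated, flipped_not_square⟩

/-- The `¬∀`-schema form: «iso-rung ∧ three pins ∧ bridge hypotheses ∧ typed Thm. 3.11 ⟹ S» is FALSE. [folklore] -/
theorem not_forall_isoRung_imp_S :
    ¬ ∀ (T : ThetaIndex) (F : FullSituation T) (P : Setting F.toLatticeSituation.toSituation)
      (ρ : (∀ v : T.V, v ∈ T.Vbad → Set (F.L.StarPacket v)) → ∀ (j : T.Label) (vQ : T.VQ), Set (F.L.Packet j vQ))
      (qK : ∀ v : T.V, v ∈ T.Vbad → Set (F.L.StarPacket v)),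
      F.Statement → BridgeHyps P → PinnedRegions3 F.toLatticeSituation P ρ qK →
      III_c_IsoTransportRegion F.toLatticeSituation P.n ρ qK → PilotKummerIndRelated F.toLatticeSituation P ρ qK := fun h =>
  flipped_not_pilotKummerIndRelated
    (h splitIndex splitFull flippedSetting boxRegion qDatumFlipped splitFull_statement flippedSetting_bridgeHyps
      flippedSetting_pinnedRegions3 flipped_isoTransportRegion)

/-! ## 6. v2 (abc-iut-D2-cx gen 3, team D2 adversary; append-only) — the load-bearing distinction, isolated in the kernel

Team D2's charitable typing `Thm311Charitable_2` gives `S` (`pilotKummerIndRelated_of_charitable_2`). Relax ONE clause — read the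
square (iii)(c)-2 up to column ISOMETRIES (abc-iut-D2-typ's `III_c_KummerLinkSquareIso`, p435015) instead of up to ⟨(Ind1)∪(Ind2)⟩ —
and `S` no longer follows: at the separating instance Parts (i), (ii), (iii)(a)(b), the (iii)(c) gloss, (iii)(d) AND the iso-square
(datum and region forms, every column) hold with the typed Thm. 3.11, the three pins, the bridge hypotheses, `|log(q)| > 0` and the
typed Corollary, while `S` and the closure-square fail (`flipLast ∉ ⟨(Ind1)∪(Ind2)⟩`). Independent all-factor-flip build concordant
(HOME/plan/D2/drafts/Thm311D2IsoSeparation.cx-g3.lean). Locates / conditionally verifies; no side taken; typed ≠ proved. -/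

/-- **The DATUM form of the iso-rung `III_c_KummerLinkSquareIso` HOLDS** at the separating instance, at every column (`Φ = flipLast`,
`m = 0`). [folklore] -/
theorem flipped_kummerLinkSquareIso (n : ℤ) : III_c_KummerLinkSquareIso splitFull.toLatticeSituation n qDatumFlipped :=
  ⟨flipLast, flipLast_isoAdmAt n, 0, fun _ _ => rfl⟩

/-- **`flipLast ∉ ⟨(Ind1)∪(Ind2)⟩`**: at label `1` a capsule permutation keeps the Θ-point's all-`false` coordinate `0`, the flip
makes it `2`. [folklore] -/
theorem flipLast_not_mem_closure : flipLast ∉ Subgroup.closure (splitShells.Ind1Family ∪ splitShells.Ind2Family) := by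
  intro h
  have h1 : (1 : splitIndex.Label) ≠ 0 := by decide
  obtain ⟨σ, hσ⟩ := actsByPerm_of_mem_closure h 1 ()
  have hA : |coord 1 () (fun _ => false) (splitShells.permute 1 () σ (thetaPt 1 ()))| ≤ 1 := by
    rw [coord_permute]; exact (abs_coord_thetaPt_le_one_iff h1 () _).2 rfl
  rw [← hσ, coord_flipLast, abs_coord_thetaPt_le_one_iff h1, flipIdx_last] at hA
  simp at hA

/-- **The closure-square III-c-2 FAILS at EVERY column** (not only at the setting's): `qDatumFlipped` is no ⟨(Ind1)∪(Ind2)⟩-translate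
of the (column-constant) Θ-datum. [folklore] -/
theorem flipped_not_square_at (n : ℤ) : ¬ III_c_KummerLinkSquare splitFull.toLatticeSituation n qDatumFlipped := by
  rintro ⟨Φ, hΦ, m, h⟩
  have h1 : (1 : splitIndex.Label) ≠ 0 := by decide
  obtain ⟨σ, hσ⟩ := actsByPerm_of_mem_closure hΦ 1 ()
  have hmem : splitShells.starAut flipLast true (thetaStar true) ∈ qDatumFlipped true rfl := ⟨thetaStar true, rfl, rfl⟩
  rw [h true rfl] at hmem
  obtain ⟨ψ, hψ, hEq⟩ := hmem
  obtain rfl : ψ = thetaStar true := hψ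
  have hA : |coord 1 () (fun _ => false) (splitShells.permute 1 () σ (thetaPt 1 ()))| ≤ 1 := by
    rw [coord_permute]; exact (abs_coord_thetaPt_le_one_iff h1 () _).2 rfl
  have hj : splitShells.starAut Φ true (thetaStar true) ⟨1, h1⟩ = splitShells.starAut flipLast true (thetaStar true) ⟨1, h1⟩ := by
    rw [hEq]
  change Φ 1 () (thetaPt 1 ()) = flipLast 1 () (thetaPt 1 ()) at hj
  rw [← hσ, hj, coord_flipLast, abs_coord_thetaPt_le_one_iff h1, flipIdx_last] at hA
  simp at hA

/-- Parts (i) and (ii) of team D2's typing HOLD at P♮₁'s all-columns situation (column-constant data, everything admissible, one global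
object of degree `vol(box ∅)`, identity Kummer transport). [folklore] -/
theorem split_partI_partII : PartI splitFull.toLatticeSituation ∧ PartII splitFull.toLatticeSituation :=
  ⟨⟨fun _ => ⟨splitData_logvolInvariant, fun _ _ _ _ _ => Iff.rfl⟩,
    fun _ j _ => ⟨fun _ => trivial, Set.toFinite _, by rw [finsum_unique]; rfl⟩, fun _ _ => Relation.EqvGen.refl _⟩,
   ⟨fun _ _ _ _ _ => ⟨Iff.rfl, fun _ => rfl⟩, ⟨fun _ _ _ _ _ => subset_rfl, fun _ _ _ _ _ => subset_rfl⟩, fun _ _ _ _ => rfl,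
    fun _ _ _ => rfl⟩⟩

/-- (iii)(a)(b), the (iii)(c) gloss and (iii)(d) HOLD at P♮₁'s situation (`Φ = 1`). [folklore] -/
theorem split_partIII_minus_square : III_ab_UnitPortionLink splitFull.toLatticeSituation ∧
    III_c_Stabilized splitFull.toLatticeSituation ∧ III_d_NumberFieldLink splitFull.toLatticeSituation :=
  ⟨fun _ => ⟨1, one_mem _, fun j vQ => by
      obtain ⟨σ, hσ⟩ := actsByPerm_of_mem_closure (one_mem _) j vQ
      show (box ∅ : Set (splitShells.Packet j vQ)) = (1 : splitShells.PacketAut) j vQ '' box ∅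
      rw [image_box_of_perm hσ]; unfold permD; rw [Finset.image_empty]⟩,
    III_c_Stabilized_holds _,
    fun _ => ⟨1, one_mem _, fun j => (Set.image_univ_of_surjective (splitShells.globalAut 1 j.1).surjective).symm⟩⟩

/-- **Team D2's typing WITH THE SQUARE READ UP TO ISOMETRY holds at the separating instance** (Parts (i), (ii); (iii)(a)(b), the gloss,
(iii)(d); the iso-square in datum AND region form at the setting's column) — together with everything of §3. [folklore] -/
theorem flipped_charitable_2_iso :
    PartI splitFull.toLatticeSituation ∧ PartII splitFull.toLatticeSituation ∧ III_ab_UnitPortionLink splitFull.toLatticeSituation ∧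
      III_c_Stabilized splitFull.toLatticeSituation ∧
      III_c_KummerLinkSquareIso splitFull.toLatticeSituation flippedSetting.n qDatumFlipped ∧
      III_c_IsoTransportRegion splitFull.toLatticeSituation flippedSetting.n boxRegion qDatumFlipped ∧
      III_d_NumberFieldLink splitFull.toLatticeSituation :=
  ⟨split_partI_partII.1, split_partI_partII.2, split_partIII_minus_square.1, split_partIII_minus_square.2.1,
    flipped_kummerLinkSquareIso _, flipped_isoTransportRegion, split_partIII_minus_square.2.2⟩

/-- **THE LOAD-BEARING DISTINCTION, closed form.** It is NOT the case that team D2's typing with (iii)(c)-2 read up to column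
isometries (both named forms) — together with the typed Thm. 3.11, the bridge hypotheses, `|log(q)| > 0`, the three pins and the typed
Corollary — gives `S`; with (iii)(c)-2 read inside ⟨(Ind1)∪(Ind2)⟩ it does (`pilotKummerIndRelated_of_charitable_2`). [folklore] -/
theorem charitable_2_isoSquare_not_imp_S :
    ¬ ∀ (T : ThetaIndex) (F : FullSituation T) (P : Setting F.toLatticeSituation.toSituation)
        (ρ : (∀ v : T.V, v ∈ T.Vbad → Set (F.L.StarPacket v)) → ∀ (j : T.Label) (vQ : T.VQ), Set (F.L.Packet j vQ))
        (qK : ∀ v : T.V, v ∈ T.Vbad → Set (F.L.StarPacket v)),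
        F.Statement → PartI F.toLatticeSituation → PartII F.toLatticeSituation → III_ab_UnitPortionLink F.toLatticeSituation →
          III_c_Stabilized F.toLatticeSituation → III_c_KummerLinkSquareIso F.toLatticeSituation P.n qK →
            III_c_IsoTransportRegion F.toLatticeSituation P.n ρ qK → III_d_NumberFieldLink F.toLatticeSituation →
              BridgeHyps P → P.AbsLogQPos → PinnedRegions3 F.toLatticeSituation P ρ qK → P.Statement →
                PilotKummerIndRelated F.toLatticeSituation P ρ qK := fun h =>
  flipped_not_pilotKummerIndRelated
    (h splitIndex splitFull flippedSetting boxRegion qDatumFlipped splitFull_statement split_partI_partII.1 split_partI_partII.2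
      split_partIII_minus_square.1 split_partIII_minus_square.2.1 (flipped_kummerLinkSquareIso _) flipped_isoTransportRegion
      split_partIII_minus_square.2.2 flippedSetting_bridgeHyps flippedSetting_absLogQPos flippedSetting_pinnedRegions3
      flipped_statement)

end Summit.ABC.IUTFork.Charitable.D2

end
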